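import Summits.Ventures.PercRepro.RankLevelSetDepCountHeavyC
import Summits.Ventures.PercRepro.RankLevelSetLevelSix
import Summits.Ventures.PercRepro.S1FourCircuitCount
import Summits.Ventures.PercRepro.RankLevelSetPlaneSix
import Summits.Ventures.PercRepro.S1TriangleCount
import Summits.Ventures.PercRepro.RankLevelSetTriangleStar
import Summits.Ventures.PercRepro.RankLevelSetCorankFiveCounts
import Summits.Ventures.PercRepro.RankLevelSetPlaneTen
import Summits.Ventures.PercRepro.RankLevelSetCoreFour
import Summits.Ventures.PercRepro.RankLevelSetFrameLarge
import Summits.Ventures.PercRepro.RankLevelSetFrameQM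
import Summits.Ventures.PercRepro.RankLevelSetLevelFiveAll
import Summits.Ventures.PercRepro.RankLevelSetLevelSixGiant

/-!
# PercRepro — THE HEAVY / LIGHT COUNT AT LEVEL `6`: ONE CORE CELL, GIVEN ITS POLYNOMIAL INEQUALITY (p8, S3)

`proofs/SUBCLAIM-S3-p8.md` §3f. On the `e`-free core of rank `p` and corank `d` (`n = p + d`), with the heavy / light
split at `ν₁` (`ncard_eRk_eq_ncard_le_le_heavy`, RankLevelSetDepCountHeavyC): the small-rank nullity caps of the core
(`cnull`: a set of rank `≤ 4` has nullity `≤ 6`, rank `≤ 3` nullity `≤ 3`, rank `≤ 2` nullity `≤ 1`, rank `≤ 1`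
nullity `0` — PlaneTen / PlaneSix / LocalSparse), the circuit bounds `s₃ ≤ d(d+1)/2`, `s₄ ≤ d(d+1)(d+2)/3`,
`s_k ≤ C(d+k−1, k)`, the pair bound `#pairsF ≤ Σ_k s_k·C(n, 7−k)`, the heavy bound `2^{uG} + (n + 1)·2^{uH}` with
`uG ≥ 6 + (j+1)d − jν₁`, `uH` from one of the three `UH`-bounds, the light-big class (`b = 1`) or its absence
(`6 + ν₁ ≤ f′ + 2`, `b = 0`), and the tails `16·Σ_{j≤50} C(n, j) ≤ 2^n`, `Φ ≤ 2^{p+6}/C(p+6, 6)`: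
**`c025_core_six_heavy_cell`** — `RLS M p 6` follows from the one polynomial inequality `(P_d)` of the cell.
Axioms: standard.
-/

open scoped Matroid

namespace PercRepro

/-- The nullity cap of the `e`-free core at small rank: `cnull r = 0, 0, 1, 3, 6` for `r = 0 … 4`. -/
def cnull (r : ℕ) : ℕ := if r ≤ 1 then 0 else if r = 2 then 1 else if r = 3 then 3 else 6

namespace ThmN

open Set

variable {α : Type}

/-- **The arithmetic of one cell with a general room constant**: `Φ·U ≤ Y` from `Φ ≤ 2^{p+q}/C(p+q, q)`,
`U ≤ C(p+d, q) + N`, `2^n ≤ Y + A + B`, `K·(A + B) ≤ 2^n` and `K·(C(p+d, q) + N) ≤ L·2^{d−q}·C(p+q, q)` with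
`L + 1 = K` (night-1's `level_arith` is the case `K = 8`). -/
theorem level_arith_K {p d n q : ℕ} {K L Φ U Y A B N : ℚ} (hn : n = p + d) (hd : q ≤ d) (hK : 0 < K)
    (hL : L + 1 = K)
    (hΦ : Φ ≤ (2 : ℚ) ^ (p + q) / ((p + q).choose q : ℚ)) (hU0 : 0 ≤ U)
    (hU : U ≤ ((p + d).choose q : ℚ) + N) (hY : (2 : ℚ) ^ n ≤ Y + A + B) (hAB : K * (A + B) ≤ 2 ^ n)
    (hpoly : K * (((p + d).choose q : ℚ) + N) ≤ L * 2 ^ (d - q) * ((p + q).choose q : ℚ)) : Φ * U ≤ Y := by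
  have hc : (0 : ℚ) < ((p + q).choose q : ℚ) := by exact_mod_cast Nat.choose_pos (by omega)
  have hpow : (2 : ℚ) ^ n = 2 ^ (p + q) * 2 ^ (d - q) := by
    rw [← pow_add]; congr 1; omega
  have h1 : Φ * U ≤ (2 : ℚ) ^ (p + q) / ((p + q).choose q : ℚ) * U := mul_le_mul_of_nonneg_right hΦ hU0
  have h2 : (2 : ℚ) ^ (p + q) / ((p + q).choose q : ℚ) * U ≤
      (2 : ℚ) ^ (p + q) / ((p + q).choose q : ℚ) * (((p + d).choose q : ℚ) + N) :=
    mul_le_mul_of_nonneg_left hU (by positivity)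
  have h3 : K * ((2 : ℚ) ^ (p + q) / ((p + q).choose q : ℚ) * (((p + d).choose q : ℚ) + N)) ≤
      L * 2 ^ n := by
    rw [hpow, div_mul_eq_mul_div, ← mul_div_assoc, div_le_iff₀ hc]
    nlinarith [hpoly, pow_pos (show (0 : ℚ) < 2 by norm_num) (p + q)]
  have h4 : L * 2 ^ n ≤ K * Y := by
    have e1 : K * (2 : ℚ) ^ n ≤ K * Y + K * A + K * B := by
      have := mul_le_mul_of_nonneg_left hY hK.le
      rw [mul_add, mul_add] at this
      exact this
    have e2 : K * A + K * B ≤ 2 ^ n := by rw [← mul_add]; exact hAB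
    have e3 : L * (2 : ℚ) ^ n = K * 2 ^ n - 2 ^ n := by rw [← hL]; ring
    linarith
  have h5 : K * (Φ * U) ≤ K * Y := by
    calc K * (Φ * U) ≤ K * ((2 : ℚ) ^ (p + q) / ((p + q).choose q : ℚ) * (((p + d).choose q : ℚ) + N)) :=
          mul_le_mul_of_nonneg_left (h1.trans h2) hK.le
      _ ≤ L * 2 ^ n := h3
      _ ≤ K * Y := h4
  exact le_of_mul_le_mul_left h5 hK

/-- **The small-rank nullity caps of the core**: a set of rank `≤ r ≤ 4` has `|X| ≤ r(X) + cnull r`. -/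
theorem nullity_cap_core (M : Matroid α) [M.Finite]
    (hfree : ∀ e ∈ M.E, ∃ A ⊆ M.E \ {e}, e ∉ M.closure A ∧ e ∉ M.closure ((M.E \ {e}) \ A))
    (r : ℕ) (hr4 : r ≤ 4) :
    ∀ X ⊆ M.E, M.eRk X ≤ (r : ℕ∞) → (X.ncard : ℕ∞) ≤ M.eRk X + cnull r := by
  intro X hX hr
  have hL : ∀ e ∈ M.E, ¬ M.IsLoop e := not_isLoop_of_free M hfree
  obtain ⟨k, hk⟩ := Matroid.exists_eRk_eq_nat (M := M) hX
  rw [hk] at hr ⊢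
  have hkr : k ≤ r := by exact_mod_cast hr
  have hbound : X.ncard ≤ k + cnull k := by
    rcases Nat.lt_or_ge k 3 with h3 | h3
    · have := ncard_add_one_le_two_pow_of_eRk_le M hL hfree k X hX (by rw [hk])
      interval_cases k <;> simp [cnull] at this ⊢ <;> omega
    · rcases Nat.lt_or_ge k 4 with h4 | h4
      · have hk3 : k = 3 := by omega
        have := ncard_le_six_of_eRk_le_three_of_free M hfree hX (by rw [hk, hk3]; norm_num)
        rw [hk3]
        simp [cnull]
        omega
      · have hk4 : k = 4 := by omega
        have := ncard_le_ten_of_eRk_le_four_of_free M hfree hX (by rw [hk, hk4]; norm_num)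
        rw [hk4]
        simp [cnull]
        omega
  have hmono : cnull k ≤ cnull r := by
    unfold cnull
    split_ifs <;> omega
  exact_mod_cast (hbound.trans (by omega))

/-- **ONE CORE CELL AT LEVEL `6` WITH THE HEAVY / LIGHT COUNT, GIVEN ITS POLYNOMIAL INEQUALITY.** Parameters: the
nullity threshold `ν₁ ≥ 7`, the rank jumps `j` (rank-`6` flats) and `j′` (rank-`5` flats) with
`d + cnull(5 − j) + 1 ≤ 2ν₁` and `d + cnull(4 − j′) + 1 ≤ 2ν₁`, the exponents `uG ≥ 6 + (j+1)d − jν₁`,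
`uH` (from the plain union bound, the unique-flat bound `f′ = min 21 (5 + d)`, or the empty case), and `b ∈ {0, 1}`
with `b = 0` only when `6 + ν₁ ≤ f′ + 2` (no light big pair). -/
theorem c025_core_six_heavy_cell (M : Matroid α) [M.Finite] (p d ν₁ j j' uG uH b K a : ℕ) (hd7 : 7 ≤ d)
    (hd50 : d ≤ 50) (hν7 : 7 ≤ ν₁) (hj : 1 ≤ j) (hj5 : j ≤ 5) (hj' : 1 ≤ j') (hj'4 : j' ≤ 4)
    (hνj : d + cnull (5 - j) + 1 ≤ 2 * ν₁) (hνj' : d + cnull (4 - j') + 1 ≤ 2 * ν₁)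
    (huG : 6 + (j + 1) * d ≤ uG + j * ν₁)
    (huH : 5 + (j' + 1) * d ≤ uH + j' * ν₁ ∨ (d + 7 ≤ 2 * ν₁ ∧ min 21 (5 + d) ≤ uH) ∨
      min 21 (5 + d) + 1 ≤ 5 + ν₁)
    (hb : 6 + ν₁ ≤ min 21 (5 + d) + 2 ∨ b = 1) (hK : 2 ≤ K) (ha : min 43 (6 + d) ≤ a)
    (htail : K * (∑ j ∈ Finset.range (a + 1), (p + d).choose j + ∑ j ∈ Finset.range (d + 1), (p + d).choose j) ≤
      2 ^ (p + d))
    (hR : M.eRank = (p : ℕ∞)) (hn : M.E.ncard = p + d)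
    (hfree : ∀ e ∈ M.E, ∃ A ⊆ M.E \ {e}, e ∉ M.closure A ∧ e ∉ M.closure ((M.E \ {e}) \ A))
    (hpoly : (K : ℚ) * ((((p + d).choose 6 : ℕ) : ℚ) +
      ((∑ i ∈ Finset.range (d - 7 + 1), ((Nat.choose (min (min 21 (5 + d) - 6) (ν₁ - 2)) i : ℕ) : ℚ) / ((i : ℚ) + 1)) *
        (((d * (d + 1) / 2 : ℕ) : ℚ) * ((p + d).choose 4 : ℚ) + ((d * (d + 1) * (d + 2) / 3 : ℕ) : ℚ) * ((p + d).choose 3 : ℚ) +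
          (((d + 4).choose 5 : ℕ) : ℚ) * ((p + d).choose 2 : ℚ) + (((d + 5).choose 6 : ℕ) : ℚ) * ((p + d : ℕ) : ℚ) +
          (((d + 6).choose 7 : ℕ) : ℚ)) +
      ((b : ℕ) : ℚ) * (∑ i ∈ Finset.range (d - 7 + 1), ((Nat.choose (ν₁ - 2) i : ℕ) : ℚ) / ((i : ℚ) + 1)) *
        (((d * (d + 1) / 2 : ℕ) : ℚ) * ((p + d).choose 4 : ℚ) + ((d * (d + 1) * (d + 2) / 3 : ℕ) : ℚ) * ((p + d).choose 3 : ℚ) +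
          (((d + 4).choose 5 : ℕ) : ℚ) * ((p + d).choose 2 : ℚ) + (((d + 5).choose 6 : ℕ) : ℚ) * ((p + d : ℕ) : ℚ) +
          (((d + 6).choose 7 : ℕ) : ℚ)) +
      (2 : ℚ) ^ uG + (((p + d : ℕ) : ℚ) + 1) * (2 : ℚ) ^ uH)) ≤
      ((K - 1 : ℕ) : ℚ) * 2 ^ (d - 6) * (((p + 6).choose 6 : ℕ) : ℚ)) :
    RLS M p 6 := by
  classical
  have hEcard : M.ground_finite.toFinset.card = p + d := by
    rw [← Set.ncard_eq_toFinset_card _ M.ground_finite]; exact hn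
  -- the core is simple: every circuit has `≥ 3` elements
  have hL : ∀ e ∈ M.E, ¬ M.IsLoop e := not_isLoop_of_free M hfree
  have hs : ∀ e ∈ M.E, ∀ f ∈ M.E, e ≠ f → M.eRk {e, f} = 2 := by
    intro e he f hf hef
    have h2 : (2 : ℕ∞) ≤ M.eRk {e, f} :=
      two_le_eRk_of_two_le_ncard_of_free M hfree (pair_subset he hf) (by rw [ncard_pair hef])
    have h3 : M.eRk {e, f} ≤ 2 := by
      have := M.eRk_le_encard {e, f}
      rwa [encard_pair hef] at this
    exact le_antisymm h3 h2
  have hcirc : ∀ C, M.IsCircuit C → 3 ≤ C.encard := three_le_encard_of_circuit M hL hs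
  have hd : M.E.encard = M.eRank + d := by
    rw [hR, ← M.ground_finite.cast_ncard_eq, hn]
    push_cast
    ring
  -- the nullity cap: every `X ⊆ E` has `|X| ≤ r(X) + d`
  have hcap : ∀ X ⊆ M.E, ∀ k : ℕ, M.eRk X ≤ k → X.ncard ≤ k + d := by
    intro X hX k hr
    have h1 := Matroid.encard_le_eRk_add_of_encard_eq hX hd
    have h2 : X.encard ≤ (k : ℕ∞) + d := h1.trans (by gcongr)
    have hfin : X.Finite := M.ground_finite.subset hX
    rw [← hfin.cast_ncard_eq] at h2
    exact_mod_cast h2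
  have hflat : ∀ X ⊆ M.E, M.eRk X ≤ 6 → X.ncard ≤ min 43 (6 + d) :=
    fun X hX hr => le_min (ncard_le_fortythree_of_eRk_le_six_of_free M hfree hX hr) (hcap X hX 6 hr)
  have hflat' : ∀ X ⊆ M.E, M.eRk X ≤ ((6 - 1 : ℕ) : ℕ∞) → X.ncard ≤ min 21 (5 + d) :=
    fun X hX hr => le_min (ncard_le_twentyone_of_eRk_le_five_of_free M hfree hX (by simpa using hr))
      (hcap X hX 5 (by simpa using hr))
  -- the small-rank nullity caps
  have hc : ∀ X ⊆ M.E, M.eRk X ≤ ((6 - 2 : ℕ) : ℕ∞) → (X.ncard : ℕ∞) ≤ M.eRk X + cnull 4 :=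
    fun X hX hr => nullity_cap_core M hfree 4 (le_refl 4) X hX (by simpa using hr)
  have hc6 : cnull 4 + 1 ≤ ν₁ := by simp [cnull]; omega
  have hcj : ∀ X ⊆ M.E, M.eRk X ≤ ((6 - j - 1 : ℕ) : ℕ∞) → (X.ncard : ℕ∞) ≤ M.eRk X + cnull (5 - j) :=
    fun X hX hr => nullity_cap_core M hfree (5 - j) (by omega) X hX
      (by rwa [show (6 - j - 1 : ℕ) = 5 - j by omega] at hr)
  have hcj' : ∀ X ⊆ M.E, M.eRk X ≤ ((6 - 1 - j' - 1 : ℕ) : ℕ∞) → (X.ncard : ℕ∞) ≤ M.eRk X + cnull (4 - j') :=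
    fun X hX hr => nullity_cap_core M hfree (4 - j') (by omega) X hX
      (by rwa [show (6 - 1 - j' - 1 : ℕ) = 4 - j' by omega] at hr)
  -- (U): the heavy / light count
  have hU1 := Matroid.topCount_le_ncard_compl (M := M) hR hd 6
  have hG := Matroid.ncard_eRk_eq_ncard_le_le_heavy M 6 (min 21 (5 + d)) ν₁ hcirc d
  -- the pair classes
  have hPs : (((Matroid.pairsLight M 6 ν₁).filter (fun p => p ∈ Matroid.pairsSmall M 6 (min 21 (5 + d)))).card : ℚ) ≤
      ∑ k ∈ Finset.Icc 3 (6 + 1), ({C | M.IsCircuit C ∧ C.ncard = k}.ncard : ℚ) * (M.E.ncard.choose (6 + 1 - k) : ℚ) := by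
    have h1 := (Matroid.card_pairsLightSmall_le (M := M) 6 (min 21 (5 + d)) ν₁).trans (Matroid.card_pairsF_le 6)
    have : ((((Matroid.pairsLight M 6 ν₁).filter (fun p => p ∈ Matroid.pairsSmall M 6 (min 21 (5 + d)))).card : ℕ) : ℚ) ≤
        ((∑ k ∈ Finset.Icc 3 (6 + 1), {C | M.IsCircuit C ∧ C.ncard = k}.ncard * M.E.ncard.choose (6 + 1 - k) : ℕ) : ℚ) := by
      exact_mod_cast h1
    push_cast at this
    exact this
  have hPb : (((Matroid.pairsLight M 6 ν₁).filter (fun p => p ∉ Matroid.pairsSmall M 6 (min 21 (5 + d)))).card : ℚ) ≤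
      ((b : ℕ) : ℚ) * ∑ k ∈ Finset.Icc 3 (6 + 1), ({C | M.IsCircuit C ∧ C.ncard = k}.ncard : ℚ) * (M.E.ncard.choose (6 + 1 - k) : ℚ) := by
    rcases hb with hb0 | hb1
    · rw [Matroid.card_pairsBigLight_eq_zero 6 (min 21 (5 + d)) ν₁ hb0]
      have : (0 : ℚ) ≤ ((b : ℕ) : ℚ) * ∑ k ∈ Finset.Icc 3 (6 + 1), ({C | M.IsCircuit C ∧ C.ncard = k}.ncard : ℚ) *
          (M.E.ncard.choose (6 + 1 - k) : ℚ) := by positivity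
      simpa using this
    · rw [hb1]
      push_cast
      rw [one_mul]
      have h1 := (Matroid.card_pairsBigLight_le (M := M) 6 (min 21 (5 + d)) ν₁).trans (Matroid.card_pairsF_le 6)
      have : ((((Matroid.pairsLight M 6 ν₁).filter (fun p => p ∉ Matroid.pairsSmall M 6 (min 21 (5 + d)))).card : ℕ) : ℚ) ≤
          ((∑ k ∈ Finset.Icc 3 (6 + 1), {C | M.IsCircuit C ∧ C.ncard = k}.ncard * M.E.ncard.choose (6 + 1 - k) : ℕ) : ℚ) := by
        exact_mod_cast h1
      push_cast at this
      exact this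
  -- the heavy sets
  have hUG : (Matroid.UG M 6 ν₁).ncard ≤ uG := by
    have := Matroid.ncard_UG_le (M := M) (q := 6) (ν₁ := ν₁) (j := j) (by norm_num) hd hc hc6 hcj hνj
    omega
  have hUH : (Matroid.UH M 6 ν₁).ncard ≤ uH := by
    rcases huH with h | ⟨h1, h2⟩ | h
    · have := Matroid.ncard_UH_le (M := M) (q := 6) (ν₁ := ν₁) (j' := j') (by norm_num) hd hc hc6 hcj' hνj'
      omega
    · have hνc : d + cnull 4 + 1 ≤ 2 * ν₁ := by simp [cnull]; omega
      exact (Matroid.ncard_UH_le_of_unique (M := M) (q := 6) hd hc hνc hflat').trans h2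
    · rw [Matroid.UH_eq_empty (M := M) (q := 6) (ν₁ := ν₁) hflat' (by omega)]
      simp
  have hHv : ({B : Set α | B ⊆ M.E ∧ M.eRk B = (6 : ℕ) ∧ 6 + ν₁ ≤ (M.closure B).ncard}.ncard : ℚ) ≤
      (2 : ℚ) ^ uG + (((p + d : ℕ) : ℚ) + 1) * (2 : ℚ) ^ uH := by
    have h1 := Matroid.ncard_heavy_le (M := M) 6 ν₁
    have h2 : 2 ^ (Matroid.UG M 6 ν₁).ncard + (M.E.ncard + 1) * 2 ^ (Matroid.UH M 6 ν₁).ncard ≤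
        2 ^ uG + (p + d + 1) * 2 ^ uH := by
      rw [hn]
      exact Nat.add_le_add (Nat.pow_le_pow_right (by norm_num) hUG)
        (Nat.mul_le_mul_left _ (Nat.pow_le_pow_right (by norm_num) hUH))
    exact_mod_cast h1.trans h2
  -- the circuit bounds
  have hC1 : ∀ L ⊆ M.E, M.eRk L = 2 → L.ncard ≤ 3 :=
    fun L hL hr => ncard_le_three_of_eRk_two M hs hfree hL hr
  have hs3 : {C | M.IsCircuit C ∧ C.ncard = 3}.ncard ≤ d * (d + 1) / 2 := by
    have hT : 2 * {C | M.IsCircuit C ∧ C.ncard = 3}.ncard ≤ d * (d + 1) := S1.two_mul_ncard_triangles_le M hC1 hd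
    omega
  have hC2 : ∀ P ⊆ M.E, M.eRk P ≤ 3 → P.ncard ≤ 6 :=
    fun P hP hr => ncard_le_six_of_eRk_le_three_of_free M hfree hP hr
  have hC1' : ∀ L ⊆ M.E, M.eRk L ≤ 2 → L.ncard ≤ 3 := by
    intro L hL' hr
    have := ncard_add_one_le_two_pow_of_eRk_le M hL hfree 2 L hL' hr
    omega
  have hs4 : {C | M.IsCircuit C ∧ C.ncard = 4}.ncard ≤ d * (d + 1) * (d + 2) / 3 := by
    have hT4 : 3 * {C : Set α | M.IsCircuit C ∧ C.ncard = 4}.ncard ≤ d * (d + 1) * (d + 2) :=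
      S1.three_mul_ncard_four_circuits_le M hC1' hC2 hd
    omega
  have hs5 : {C | M.IsCircuit C ∧ C.ncard = 5}.ncard ≤ (d + 4).choose 5 :=
    Matroid.ncard_circuits_le_choose_of_encard M hd 4
  have hs6 : {C | M.IsCircuit C ∧ C.ncard = 6}.ncard ≤ (d + 5).choose 6 :=
    Matroid.ncard_circuits_le_choose_of_encard M hd 5
  have hs7 : {C | M.IsCircuit C ∧ C.ncard = 7}.ncard ≤ (d + 6).choose 7 :=
    Matroid.ncard_circuits_le_choose_of_encard M hd 6
  have hs3q : ({C | M.IsCircuit C ∧ C.ncard = 3}.ncard : ℚ) ≤ ((d * (d + 1) / 2 : ℕ) : ℚ) := by exact_mod_cast hs3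
  have hs4q : ({C | M.IsCircuit C ∧ C.ncard = 4}.ncard : ℚ) ≤ ((d * (d + 1) * (d + 2) / 3 : ℕ) : ℚ) := by
    exact_mod_cast hs4
  have hs5q : ({C | M.IsCircuit C ∧ C.ncard = 5}.ncard : ℚ) ≤ (((d + 4).choose 5 : ℕ) : ℚ) := by exact_mod_cast hs5
  have hs6q : ({C | M.IsCircuit C ∧ C.ncard = 6}.ncard : ℚ) ≤ (((d + 5).choose 6 : ℕ) : ℚ) := by exact_mod_cast hs6
  have hs7q : ({C | M.IsCircuit C ∧ C.ncard = 7}.ncard : ℚ) ≤ (((d + 6).choose 7 : ℕ) : ℚ) := by exact_mod_cast hs7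
  -- the pair sum in explicit form
  have hPexp : ∑ k ∈ Finset.Icc 3 (6 + 1), ({C | M.IsCircuit C ∧ C.ncard = k}.ncard : ℚ) * (M.E.ncard.choose (6 + 1 - k) : ℚ) ≤
      ((d * (d + 1) / 2 : ℕ) : ℚ) * ((p + d).choose 4 : ℚ) + ((d * (d + 1) * (d + 2) / 3 : ℕ) : ℚ) * ((p + d).choose 3 : ℚ) +
        (((d + 4).choose 5 : ℕ) : ℚ) * ((p + d).choose 2 : ℚ) + (((d + 5).choose 6 : ℕ) : ℚ) * ((p + d : ℕ) : ℚ) +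
        (((d + 6).choose 7 : ℕ) : ℚ) := by
    rw [show (6 : ℕ) + 1 = 7 from rfl, sum_Icc_three_seven_q, hn]
    simp only [show (7 : ℕ) - 3 = 4 from rfl, show (7 : ℕ) - 4 = 3 from rfl, show (7 : ℕ) - 5 = 2 from rfl,
      show (7 : ℕ) - 6 = 1 from rfl, show (7 : ℕ) - 7 = 0 from rfl, Nat.choose_one_right, Nat.choose_zero_right,
      mul_one, Nat.cast_one]
    gcongr
  set Pq := ((d * (d + 1) / 2 : ℕ) : ℚ) * ((p + d).choose 4 : ℚ) + ((d * (d + 1) * (d + 2) / 3 : ℕ) : ℚ) * ((p + d).choose 3 : ℚ) +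
        (((d + 4).choose 5 : ℕ) : ℚ) * ((p + d).choose 2 : ℚ) + (((d + 5).choose 6 : ℕ) : ℚ) * ((p + d : ℕ) : ℚ) +
        (((d + 6).choose 7 : ℕ) : ℚ) with hPq
  have hσ1 : (0 : ℚ) ≤ ∑ i ∈ Finset.range (d - (6 + 1) + 1), ((Nat.choose (min (min 21 (5 + d) - 6) (ν₁ - 2)) i : ℕ) : ℚ) / ((i : ℚ) + 1) :=
    Finset.sum_nonneg (fun i _ => by positivity)
  have hσ2 : (0 : ℚ) ≤ ∑ i ∈ Finset.range (d - (6 + 1) + 1), ((Nat.choose (ν₁ - 2) i : ℕ) : ℚ) / ((i : ℚ) + 1) :=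
    Finset.sum_nonneg (fun i _ => by positivity)
  have hUq : (Matroid.topCount M p 6 : ℚ) ≤ ((p + d).choose 6 : ℚ) +
      ((∑ i ∈ Finset.range (d - 7 + 1), ((Nat.choose (min (min 21 (5 + d) - 6) (ν₁ - 2)) i : ℕ) : ℚ) / ((i : ℚ) + 1)) * Pq +
        ((b : ℕ) : ℚ) * (∑ i ∈ Finset.range (d - 7 + 1), ((Nat.choose (ν₁ - 2) i : ℕ) : ℚ) / ((i : ℚ) + 1)) * Pq +
        (2 : ℚ) ^ uG + (((p + d : ℕ) : ℚ) + 1) * (2 : ℚ) ^ uH) := by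
    have h1 : (Matroid.topCount M p 6 : ℚ) ≤
        ({B : Set α | B ⊆ M.E ∧ M.eRk B = 6 ∧ B.ncard ≤ d}.ncard : ℚ) := by exact_mod_cast hU1
    refine h1.trans (hG.trans ?_)
    have e1 := mul_le_mul_of_nonneg_left (hPs.trans hPexp) hσ1
    have e2 := mul_le_mul_of_nonneg_left (hPb.trans (mul_le_mul_of_nonneg_left hPexp (by positivity))) hσ2
    simp only [show (6 : ℕ) + 1 = 7 from rfl] at e1 e2 ⊢
    rw [hn]
    have h3 := add_le_add (add_le_add (add_le_add (le_refl (((p + d).choose 6 : ℕ) : ℚ)) e1) e2) hHv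
    refine h3.trans (le_of_eq ?_)
    ring
  -- (Y)
  have hY := Matroid.two_pow_le_midCount_add (M := M) p 6 hR
  have hA : {X : Set α | X ⊆ M.E ∧ M.eRk X ≤ 6}.ncard ≤ ∑ j ∈ Finset.range (a + 1), (p + d).choose j := by
    calc {X : Set α | X ⊆ M.E ∧ M.eRk X ≤ 6}.ncard
        ≤ {X : Set α | X ⊆ (M.ground_finite.toFinset : Set α) ∧ X.ncard ≤ a}.ncard := by
          apply ncard_le_ncard
          · intro X hX
            exact ⟨by rw [Set.Finite.coe_toFinset]; exact hX.1, (hflat X hX.1 hX.2).trans ha⟩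
          · exact (Finset.finite_toSet _).finite_subsets.subset (fun X hX => hX.1)
      _ ≤ ∑ j ∈ Finset.range (a + 1), M.ground_finite.toFinset.card.choose j :=
          ncard_subsets_ncard_le _ a
      _ = ∑ j ∈ Finset.range (a + 1), (p + d).choose j := by rw [hEcard]
  have hB := Matroid.ncard_spanning_le (M := M) hd
  rw [hEcard] at hY hB
  -- the tails
  have hAB : K * ({X : Set α | X ⊆ M.E ∧ M.eRk X ≤ 6}.ncard +
      {X : Set α | X ⊆ M.E ∧ M.eRk X = M.eRank}.ncard) ≤ 2 ^ (p + d) := by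
    have h1 : K * ({X : Set α | X ⊆ M.E ∧ M.eRk X ≤ 6}.ncard +
        {X : Set α | X ⊆ M.E ∧ M.eRk X = M.eRank}.ncard) ≤
        K * (∑ j ∈ Finset.range (a + 1), (p + d).choose j + ∑ j ∈ Finset.range (d + 1), (p + d).choose j) :=
      Nat.mul_le_mul_left _ (Nat.add_le_add hA hB)
    exact h1.trans htail
  -- (Φ) and the polynomial inequality
  have hΦ := phiK_le_two_pow_div p 6
  rw [Nat.choose_symm_add] at hΦ
  -- assemble in `ℚ`
  rw [RLS_iff]
  have hYq : (2 : ℚ) ^ (p + d) ≤ (Matroid.midCount M p 6 : ℚ) +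
      ({X : Set α | X ⊆ M.E ∧ M.eRk X ≤ 6}.ncard : ℚ) +
      ({X : Set α | X ⊆ M.E ∧ M.eRk X = M.eRank}.ncard : ℚ) := by exact_mod_cast hY
  have hABq : (K : ℚ) * (({X : Set α | X ⊆ M.E ∧ M.eRk X ≤ 6}.ncard : ℚ) +
      ({X : Set α | X ⊆ M.E ∧ M.eRk X = M.eRank}.ncard : ℚ)) ≤ 2 ^ (p + d) := by exact_mod_cast hAB
  have hU0 : (0 : ℚ) ≤ (Matroid.topCount M p 6 : ℚ) := Nat.cast_nonneg _
  have hd6 : 6 ≤ d := by omega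
  have hKq : (0 : ℚ) < (K : ℚ) := by exact_mod_cast (by omega : 0 < K)
  have hLq : ((K - 1 : ℕ) : ℚ) + 1 = (K : ℚ) := by
    rw [Nat.cast_sub (by omega : 1 ≤ K)]
    push_cast
    ring
  exact level_arith_K (p := p) (d := d) (n := p + d) (q := 6) rfl hd6 hKq hLq hΦ hU0 hUq hYq hABq hpoly

end ThmN

end PercRepro
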